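import Summits.Ventures.PercRepro.HyperplaneKeyUniformSharp

/-!
# PercRepro — THE UNIFORM SHARP KEY WITH THE FALLING FACTORIAL KEPT EXACT (p1, gen 44; an S3 / S4 feeder — no window claim here)

`HyperplaneKeyUniformSharp` bounds `C(p+q, p)·q! = (p+1)(p+2)⋯(p+q)` below by `(p+1)^q` and the ratio `n/(p+1)` by its value at
the base rank. Keeping the product: `n^q/((p+1)⋯(p+q)) = ∏_{k=1}^{q} n/(p+k)` and, on `n = 2p + m` with `p ≥ p₀` and `m ≥ 2q`,
each factor `(2p+m)/(p+k) ≤ (2p₀+m)/(p₀+k)` (`div_le_div_of_ge'`), so `(Φ+1)·A(n) ≤ 2^p · G'(m)` with the one-variable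
`G'(m) = 2^q·W·(2p₀+m)^q / C(p₀+q, p₀)` (`prod_div_le`) — the constants of the key improve by `2·log₂(∏_{k≤q}(p₀+k)/(p₀+1)^q)`,
about `5` points at level `7` and `6` at level `8` (`rls_of_hyperplane_key_uniform_weighted'`; the instances are in
`HyperplaneKeyUniformLadder`). Coloops are not excluded; nothing is claimed below the thresholds.
Axioms: standard.
-/

open scoped Matroid

namespace PercRepro

namespace HypKey

open Set

variable {α : Type}

/-- On `n = 2p + m` with `p₀ ≤ p`, `1 ≤ k` and `2k ≤ m`: `n/(p+k) ≤ (2p₀+m)/(p₀+k)`. -/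
theorem div_le_div_of_ge' (p₀ p m k : ℕ) (hp : p₀ ≤ p) (hk : 1 ≤ k) (hm : 2 * k ≤ m) :
    ((2 * p + m : ℕ) : ℚ) / ((p + k : ℕ) : ℚ) ≤ ((2 * p₀ + m : ℕ) : ℚ) / ((p₀ + k : ℕ) : ℚ) := by
  have h1 : (0 : ℚ) < ((p + k : ℕ) : ℚ) := by
    have : 0 < p + k := by omega
    exact_mod_cast this
  have h2 : (0 : ℚ) < ((p₀ + k : ℕ) : ℚ) := by
    have : 0 < p₀ + k := by omega
    exact_mod_cast this
  rw [div_le_div_iff₀ h1 h2]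
  have h3 : (2 * p + m) * (p₀ + k) ≤ (2 * p₀ + m) * (p + k) := by
    obtain ⟨d, rfl⟩ := Nat.exists_eq_add_of_le hp
    have := Nat.mul_le_mul_left d hm
    nlinarith
  exact_mod_cast h3

/-- **The product bound**: on `n = 2p + m` with `p₀ ≤ p` and `2q ≤ m`,
`n^q / (C(p+q, p)·q!) ≤ (2p₀+m)^q / (C(p₀+q, p₀)·q!)`. -/
theorem prod_div_le (p₀ p m q : ℕ) (hp : p₀ ≤ p) (hm : 2 * q ≤ m) :
    ((2 * p + m : ℕ) : ℚ) ^ q / (((p + q).choose p : ℚ) * (q.factorial : ℚ)) ≤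
      ((2 * p₀ + m : ℕ) : ℚ) ^ q / (((p₀ + q).choose p₀ : ℚ) * (q.factorial : ℚ)) := by
  -- `C(p+q, p)·q! = ∏_{i<q} (p + q − i)` as a product in `ℚ`
  have hprod : ∀ r : ℕ, ((r + q).choose r : ℚ) * (q.factorial : ℚ) = ∏ i ∈ Finset.range q, ((r + q - i : ℕ) : ℚ) := by
    intro r
    have h := Nat.descFactorial_eq_prod_range (r + q) q
    rw [Nat.descFactorial_eq_factorial_mul_choose, ← Nat.choose_symm_add] at h
    have h' : ((r + q).choose r : ℚ) * (q.factorial : ℚ) = ((q.factorial * (r + q).choose r : ℕ) : ℚ) := by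
      push_cast
      ring
    rw [h', h]
    push_cast
    rfl
  have hpow : ∀ x : ℕ, ((x : ℕ) : ℚ) ^ q = ∏ _i ∈ Finset.range q, ((x : ℕ) : ℚ) := by
    intro x
    rw [Finset.prod_const, Finset.card_range]
  rw [hprod p, hprod p₀, hpow (2 * p + m), hpow (2 * p₀ + m), ← Finset.prod_div_distrib, ← Finset.prod_div_distrib]
  refine Finset.prod_le_prod (fun i _ => by positivity) (fun i hi => ?_)
  have hi : i < q := Finset.mem_range.1 hi
  have e1 : p + q - i = p + (q - i) := by omega
  have e2 : p₀ + q - i = p₀ + (q - i) := by omega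
  rw [e1, e2]
  exact div_le_div_of_ge' p₀ p m (q - i) hp (by omega) (by omega)

/-- **THE SHARP KEY, UNIFORM IN `p`, WITH THE FALLING FACTORIAL KEPT.** `e`-free, `ρ(E) = p ≥ p₀`, a cap
`#{ρ ≤ q} ≤ Σ_{j≤q} C(n, j)·w_j`, `n ≥ 2p + m₀`, `2q ≤ m₀`, `4q ≤ 2p₀ + m₀`, and the one-variable key
`G'(m) = 2^q·(Σ_{j≤q} w_j/j!)·(2p₀+m)^q / C(p₀+q, p₀) ≤ 2^{⌊m/2⌋}` at `m = m₀` and `m = m₀ + 1` give `ThmN.RLS M p q`. -/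
theorem rls_of_hyperplane_key_uniform_weighted' (M : Matroid α) [M.Finite] (p q : ℕ) (hR : M.eRank = (p : ℕ∞))
    (hfree : ∀ e ∈ M.E, ∃ A ⊆ M.E \ {e}, e ∉ M.closure A ∧ e ∉ M.closure ((M.E \ {e}) \ A))
    (w : ℕ → ℕ)
    (hcount : {X : Set α | X ⊆ M.E ∧ M.eRk X ≤ (q : ℕ∞)}.ncard ≤ ∑ j ∈ Finset.range (q + 1), M.E.ncard.choose j * w j)
    (hq : 1 ≤ q) (p₀ m₀ : ℕ) (hp : p₀ ≤ p) (h2 : 2 * q ≤ m₀) (h4 : 4 * q ≤ 2 * p₀ + m₀) (hn : 2 * p + m₀ ≤ M.E.ncard)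
    (h0 : (2 : ℚ) ^ q * (∑ j ∈ Finset.range (q + 1), (w j : ℚ) / (j.factorial : ℚ)) *
        (((2 * p₀ + m₀ : ℕ) : ℚ) ^ q / ((p₀ + q).choose p₀ : ℚ)) ≤ (2 : ℚ) ^ (m₀ / 2))
    (h1 : (2 : ℚ) ^ q * (∑ j ∈ Finset.range (q + 1), (w j : ℚ) / (j.factorial : ℚ)) *
        (((2 * p₀ + (m₀ + 1) : ℕ) : ℚ) ^ q / ((p₀ + q).choose p₀ : ℚ)) ≤ (2 : ℚ) ^ ((m₀ + 1) / 2)) :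
    ThmN.RLS M p q := by
  set n := M.E.ncard with hn_def
  set m := n - 2 * p with hm_def
  have hnm : n = 2 * p + m := by omega
  have hm₀ : m₀ ≤ m := by omega
  set W : ℚ := ∑ j ∈ Finset.range (q + 1), (w j : ℚ) / (j.factorial : ℚ) with hW
  have hWnn : 0 ≤ W := Finset.sum_nonneg (fun j _ => by positivity)
  have hC0 : (0 : ℚ) < ((p₀ + q).choose p₀ : ℚ) := by
    exact_mod_cast Nat.choose_pos (by omega)
  -- the one-variable key
  set G : ℕ → ℚ := fun k => (2 : ℚ) ^ q * W * (((2 * p₀ + k : ℕ) : ℚ) ^ q / ((p₀ + q).choose p₀ : ℚ)) with hG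
  have hGstep : ∀ k, m₀ ≤ k → G (k + 2) ≤ 2 * G k := by
    intro k hk
    simp only [hG]
    have hy0 : (0 : ℚ) < ((2 * p₀ + k : ℕ) : ℚ) := by
      have : 0 < 2 * p₀ + k := by omega
      exact_mod_cast this
    have hy : 4 * (q : ℚ) ≤ ((2 * p₀ + k : ℕ) : ℚ) := by
      have h5 : 4 * q ≤ 2 * p₀ + k := by omega
      exact_mod_cast h5
    have hdbl := pow_add_two_le_two_mul_pow q _ hy hy0
    have hsplit : ((2 * p₀ + (k + 2) : ℕ) : ℚ) = ((2 * p₀ + k : ℕ) : ℚ) + 2 := by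
      push_cast
      ring
    rw [hsplit]
    have hc : 0 ≤ (2 : ℚ) ^ q * W := by positivity
    calc (2 : ℚ) ^ q * W * ((((2 * p₀ + k : ℕ) : ℚ) + 2) ^ q / ((p₀ + q).choose p₀ : ℚ))
        ≤ (2 : ℚ) ^ q * W * ((2 * ((2 * p₀ + k : ℕ) : ℚ) ^ q) / ((p₀ + q).choose p₀ : ℚ)) := by
          gcongr
      _ = 2 * ((2 : ℚ) ^ q * W * (((2 * p₀ + k : ℕ) : ℚ) ^ q / ((p₀ + q).choose p₀ : ℚ))) := by ring
  have hGm : G m ≤ (2 : ℚ) ^ (m / 2) := key_of_two_base G m₀ hGstep h0 h1 m hm₀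
  -- the cap in `ℚ`
  have hn1 : 1 ≤ n := by omega
  have hcap : ({X : Set α | X ⊆ M.E ∧ M.eRk X ≤ (q : ℕ∞)}.ncard : ℚ) ≤ W * (n : ℚ) ^ q := by
    have hc1 : ({X : Set α | X ⊆ M.E ∧ M.eRk X ≤ (q : ℕ∞)}.ncard : ℚ) ≤
        ∑ j ∈ Finset.range (q + 1), (n.choose j : ℚ) * (w j : ℚ) := by
      rw [hn_def]
      exact_mod_cast hcount
    exact hc1.trans (sum_choose_mul_le_pow q n hn1 w)
  -- the `p`-side
  have hΦ := phiK_add_one_mul_choose_le p q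
  have hΦnn : 0 ≤ phiK p q + 1 := by linarith [phiK_nonneg p q]
  have hC : (0 : ℚ) < ((p + q).choose p : ℚ) := by
    exact_mod_cast Nat.choose_pos (by omega)
  have hf : (0 : ℚ) < (q.factorial : ℚ) := by exact_mod_cast Nat.factorial_pos q
  have hratio := prod_div_le p₀ p m q hp (by omega)
  have hnq : (n : ℚ) ^ q = ((2 * p + m : ℕ) : ℚ) ^ q := by rw [hnm]
  have hhalf : n / 2 = p + m / 2 := by omega
  refine rls_of_hyperplane_key M p q hR hfree (W * (n : ℚ) ^ q) hcap ?_
  rw [hhalf, pow_add]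
  have hkey : (phiK p q + 1) * (W * (n : ℚ) ^ q) =
      ((phiK p q + 1) * ((p + q).choose p : ℚ)) * (q.factorial : ℚ) * W *
        ((n : ℚ) ^ q / (((p + q).choose p : ℚ) * (q.factorial : ℚ))) := by
    field_simp
  calc (phiK p q + 1) * (W * (n : ℚ) ^ q)
      = ((phiK p q + 1) * ((p + q).choose p : ℚ)) * (q.factorial : ℚ) * W *
        ((n : ℚ) ^ q / (((p + q).choose p : ℚ) * (q.factorial : ℚ))) := hkey
    _ ≤ (2 : ℚ) ^ (p + q) * (q.factorial : ℚ) * W *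
        ((n : ℚ) ^ q / (((p + q).choose p : ℚ) * (q.factorial : ℚ))) := by gcongr
    _ = (2 : ℚ) ^ (p + q) * (q.factorial : ℚ) * W *
        (((2 * p + m : ℕ) : ℚ) ^ q / (((p + q).choose p : ℚ) * (q.factorial : ℚ))) := by rw [hnq]
    _ ≤ (2 : ℚ) ^ (p + q) * (q.factorial : ℚ) * W *
        (((2 * p₀ + m : ℕ) : ℚ) ^ q / (((p₀ + q).choose p₀ : ℚ) * (q.factorial : ℚ))) := by gcongr
    _ = (2 : ℚ) ^ p * G m := by
        simp only [hG]
        rw [pow_add]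
        field_simp
    _ ≤ (2 : ℚ) ^ p * (2 : ℚ) ^ (m / 2) := by gcongr

end HypKey

end PercRepro
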